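import Summits.ValiantsHypothesis.ValiantsHypothesis.Theorems.SymPencilEquivariantSdcNotQPInvariantSubspaceDets
import HarnessLib

/-!
# ValiantsHypothesis / SymPencil — crux `EquivariantSdcNotQP` (stmt-ValiantsHypothesis-17792), line
# `birth_EquivariantSdcNotQP`, open piece (ii′) `FiniteConjugationLift` of `stub_permify`:
# PART B — the canonical pair `U < W⋆` of a pencil with irreducible determinant

For a pencil `B : Matrix (Fin m) (Fin m) (MvPolynomial σ ℂ)` (`B(a) := toLin' (B.map (eval a))`) every
subspace `W` invariant under all `B(a)` has a restriction polynomial `P_W` (`P_W(a) = det B(a)|_W`,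
Part A).  This file (helper of the item, `--supports stmt-ValiantsHypothesis-17792 --as helper`; no
definitions, no named facts) proves:
* `poly_restrict_mul_compression`, `poly_restrict_dvd_det` — `P_W · Q_C = det B`, so `P_W ∣ det B`;
* `isUnit_or_det_dvd`, `not_isUnit_of_det_dvd` — with `det B` irreducible, `P_W` is a unit or a
  multiple of `det B`, never both;
* `poly_sup_mul_inf` — `P_{W₁+W₂} · P_{W₁∩W₂} = P_{W₁} · P_{W₂}` (from Part A's determinant identity,
  `MvPolynomial.funext`);
* `exists_canonical_pair` — **if `det B` is irreducible there are invariant `U < W⋆`** with `P_{W⋆}`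
  a multiple of `det B`, `P_U` a unit, every invariant PROPER subspace of `W⋆` below `U` (so `W⋆/U`
  is a simple module for the coefficient algebra and carries `det B`), and BOTH FIXED by every
  linear automorphism `G` conjugating the pencil into a renaming of itself (`B(a) G = G B(a ∘ f)`,
  `rename f (det B) = det B`).  Proof without Jordan–Hölder: the `det B`-carrying invariant
  subspaces are closed under `∩` (lattice identity + irreducibility), so the least one `W⋆` exists
  (least dimension); inside it the unit-carrying invariant subspaces are closed under `+`, so the
  largest proper one `U` exists; transported subspaces `G W` are invariant with `P_{GW} = rename f P_W`,
  and dimension pins `G W⋆ = W⋆`, `G U = U`.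
This is steps "composition factor + canonicity" of the intended route to (ii′); the remaining steps
(compressed pencil on `W⋆/U`, induced lifts, Schur, `det`-one normalisation) follow in Part C.

Honest framing: (ii′), `stub_permify`, the crux `SymPencil.EquivariantSdcNotQP` and `VP ≠ VNP`
remain OPEN; nothing here is progress on them.
-/

noncomputable section

set_option linter.dupNamespace false

namespace Summit.ValiantsHypothesis.ValiantsHypothesis.Theorems.SymPencilEquivariantSdcNotQP

open Module Submodule

/-! ## Part B — the canonical pair `U < W⋆` of a pencil with irreducible determinant -/

section Lattice

open MvPolynomial Matrix

variable {σ : Type*} {m : ℕ} (B : Matrix (Fin m) (Fin m) (MvPolynomial σ ℂ))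

/-- `P_W · Q_C = det B` for the restriction polynomial of an invariant `W` and the compression
polynomial of a complement `C`. [folklore] -/
theorem poly_restrict_mul_compression {W C : Submodule ℂ (Fin m → ℂ)}
    (hW : ∀ a : σ → ℂ, W ≤ W.comap (Matrix.toLin' (B.map (MvPolynomial.eval a))))
    (hWC : IsCompl W C) {P Q : MvPolynomial σ ℂ}
    (hP : ∀ a, MvPolynomial.eval a P =
      LinearMap.det ((Matrix.toLin' (B.map (MvPolynomial.eval a))).restrict (hW a)))
    (hQ : ∀ a, MvPolynomial.eval a Q = LinearMap.det (C.projectionOnto W hWC.symm ∘ₗ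
      Matrix.toLin' (B.map (MvPolynomial.eval a)) ∘ₗ C.subtype)) :
    P * Q = B.det := by
  refine MvPolynomial.funext fun a => ?_
  rw [map_mul, hP a, hQ a, ← det_eq_det_restrict_mul_det_compression _ (hW a) hWC,
    LinearMap.det_toLin', RingHom.map_det, RingHom.mapMatrix_apply]

/-- Every restriction polynomial divides `det B`. [folklore] -/
theorem poly_restrict_dvd_det {W : Submodule ℂ (Fin m → ℂ)}
    (hW : ∀ a : σ → ℂ, W ≤ W.comap (Matrix.toLin' (B.map (MvPolynomial.eval a))))
    {P : MvPolynomial σ ℂ}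
    (hP : ∀ a, MvPolynomial.eval a P =
      LinearMap.det ((Matrix.toLin' (B.map (MvPolynomial.eval a))).restrict (hW a))) :
    P ∣ B.det := by
  obtain ⟨C, hWC⟩ := W.exists_isCompl
  obtain ⟨Q, hQ⟩ := exists_poly_det_compression B (C.projectionOnto W hWC.symm) C.subtype
  exact ⟨Q, (poly_restrict_mul_compression B hW hWC hP hQ).symm⟩

/-- Dichotomy: with `det B` irreducible, a restriction polynomial is a unit or a multiple of
`det B`, and not both. [folklore] -/
theorem isUnit_or_det_dvd (hirr : Irreducible B.det) {W : Submodule ℂ (Fin m → ℂ)}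
    (hW : ∀ a : σ → ℂ, W ≤ W.comap (Matrix.toLin' (B.map (MvPolynomial.eval a))))
    {P : MvPolynomial σ ℂ}
    (hP : ∀ a, MvPolynomial.eval a P =
      LinearMap.det ((Matrix.toLin' (B.map (MvPolynomial.eval a))).restrict (hW a))) :
    IsUnit P ∨ B.det ∣ P := by
  obtain ⟨Q, hQ⟩ := poly_restrict_dvd_det B hW hP
  rcases hirr.isUnit_or_isUnit hQ with hu | hu
  · exact Or.inl hu
  · refine Or.inr ⟨↑hu.unit⁻¹, ?_⟩
    rw [hQ, mul_assoc, IsUnit.mul_val_inv, mul_one]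

/-- … not both. [folklore] -/
theorem not_isUnit_of_det_dvd (hirr : Irreducible B.det) {P : MvPolynomial σ ℂ}
    (hd : B.det ∣ P) : ¬ IsUnit P :=
  fun hu => hirr.not_isUnit (isUnit_of_dvd_unit hd hu)

/-- The lattice identity for the polynomials: `P_{W₁+W₂} · P_{W₁∩W₂} = P_{W₁} · P_{W₂}`. [folklore] -/
theorem poly_sup_mul_inf {W₁ W₂ : Submodule ℂ (Fin m → ℂ)}
    (h₁ : ∀ a : σ → ℂ, W₁ ≤ W₁.comap (Matrix.toLin' (B.map (MvPolynomial.eval a))))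
    (h₂ : ∀ a : σ → ℂ, W₂ ≤ W₂.comap (Matrix.toLin' (B.map (MvPolynomial.eval a))))
    (hsup : ∀ a : σ → ℂ, W₁ ⊔ W₂ ≤ (W₁ ⊔ W₂).comap (Matrix.toLin' (B.map (MvPolynomial.eval a))))
    (hinf : ∀ a : σ → ℂ, W₁ ⊓ W₂ ≤ (W₁ ⊓ W₂).comap (Matrix.toLin' (B.map (MvPolynomial.eval a))))
    {P₁ P₂ Ps Pi : MvPolynomial σ ℂ}
    (hP₁ : ∀ a, MvPolynomial.eval a P₁ =
      LinearMap.det ((Matrix.toLin' (B.map (MvPolynomial.eval a))).restrict (h₁ a)))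
    (hP₂ : ∀ a, MvPolynomial.eval a P₂ =
      LinearMap.det ((Matrix.toLin' (B.map (MvPolynomial.eval a))).restrict (h₂ a)))
    (hPs : ∀ a, MvPolynomial.eval a Ps =
      LinearMap.det ((Matrix.toLin' (B.map (MvPolynomial.eval a))).restrict (hsup a)))
    (hPi : ∀ a, MvPolynomial.eval a Pi =
      LinearMap.det ((Matrix.toLin' (B.map (MvPolynomial.eval a))).restrict (hinf a))) :
    Ps * Pi = P₁ * P₂ := by
  refine MvPolynomial.funext fun a => ?_
  rw [map_mul, map_mul, hP₁, hP₂, hPs, hPi]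
  exact det_restrict_sup_mul_inf _ (h₁ a) (h₂ a) (hsup a) (hinf a)

/-- Invariance of sums. [folklore] -/
theorem sup_le_comap_of {K V : Type*} [Field K] [AddCommGroup V] [Module K V] (T : V →ₗ[K] V)
    {W₁ W₂ : Submodule K V} (h₁ : W₁ ≤ W₁.comap T) (h₂ : W₂ ≤ W₂.comap T) :
    W₁ ⊔ W₂ ≤ (W₁ ⊔ W₂).comap T :=
  sup_le (h₁.trans (Submodule.comap_mono le_sup_left)) (h₂.trans (Submodule.comap_mono le_sup_right))

/-- Invariance of intersections. [folklore] -/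
theorem inf_le_comap_of {K V : Type*} [Field K] [AddCommGroup V] [Module K V] (T : V →ₗ[K] V)
    {W₁ W₂ : Submodule K V} (h₁ : W₁ ≤ W₁.comap T) (h₂ : W₂ ≤ W₂.comap T) :
    W₁ ⊓ W₂ ≤ (W₁ ⊓ W₂).comap T := by
  intro x hx
  rw [Submodule.mem_comap, Submodule.mem_inf]
  exact ⟨h₁ hx.1, h₂ hx.2⟩

/-- Equal invariant subspaces have equal restricted determinants (the invariance proofs may
differ). [folklore] -/
theorem det_restrict_congr {K V : Type*} [Field K] [AddCommGroup V] [Module K V] (T : V →ₗ[K] V)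
    {W W' : Submodule K V} (h : W = W') (hW : W ≤ W.comap T) (hW' : W' ≤ W'.comap T) :
    LinearMap.det (T.restrict hW) = LinearMap.det (T.restrict hW') := by
  subst h
  rfl

/-- **The canonical pair.**  If `det B` is irreducible there are invariant subspaces `U < W⋆`
with: `P_{W⋆}` a multiple of `det B` and `W⋆` below every invariant subspace with that property
(so `W⋆` is the least `det B`-carrying invariant subspace); `P_U` a unit and `U` above every
invariant proper subspace of `W⋆` (so `W⋆/U` is simple for the coefficient algebra); and both are
fixed by every linear automorphism `G` that conjugates the pencil into a renaming of itself,
`B(a) G = G B(a ∘ f)`. [folklore] -/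
theorem exists_canonical_pair (hirr : Irreducible B.det) :
    ∃ (Wst U : Submodule ℂ (Fin m → ℂ))
      (hWst : ∀ a : σ → ℂ, Wst ≤ Wst.comap (Matrix.toLin' (B.map (MvPolynomial.eval a))))
      (hU : ∀ a : σ → ℂ, U ≤ U.comap (Matrix.toLin' (B.map (MvPolynomial.eval a)))),
      U < Wst ∧
      (∃ P : MvPolynomial σ ℂ, (∀ a, MvPolynomial.eval a P =
        LinearMap.det ((Matrix.toLin' (B.map (MvPolynomial.eval a))).restrict (hWst a))) ∧
          B.det ∣ P) ∧
      (∃ P : MvPolynomial σ ℂ, (∀ a, MvPolynomial.eval a P =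
        LinearMap.det ((Matrix.toLin' (B.map (MvPolynomial.eval a))).restrict (hU a))) ∧
          IsUnit P) ∧
      (∀ (W : Submodule ℂ (Fin m → ℂ))
        (hW : ∀ a : σ → ℂ, W ≤ W.comap (Matrix.toLin' (B.map (MvPolynomial.eval a)))),
        W < Wst → W ≤ U) ∧
      (∀ (G : (Fin m → ℂ) ≃ₗ[ℂ] (Fin m → ℂ)) (f : σ → σ),
        (∀ a : σ → ℂ, Matrix.toLin' (B.map (MvPolynomial.eval a)) ∘ₗ (G : (Fin m → ℂ) →ₗ[ℂ] (Fin m → ℂ)) =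
          (G : (Fin m → ℂ) →ₗ[ℂ] (Fin m → ℂ)) ∘ₗ Matrix.toLin' (B.map (MvPolynomial.eval (a ∘ f)))) →
        MvPolynomial.rename f B.det = B.det →
        Wst.map (G : (Fin m → ℂ) →ₗ[ℂ] (Fin m → ℂ)) = Wst ∧ U.map (G : (Fin m → ℂ) →ₗ[ℂ] (Fin m → ℂ)) = U) := by
  classical
  -- abbreviations
  set T : (σ → ℂ) → ((Fin m → ℂ) →ₗ[ℂ] (Fin m → ℂ)) :=
    fun a => Matrix.toLin' (B.map (MvPolynomial.eval a)) with hT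
  -- `Carries W` : invariant, and its polynomial is a multiple of `det B`
  let Inv : Submodule ℂ (Fin m → ℂ) → Prop := fun W => ∀ a, W ≤ W.comap (T a)
  let Carries : Submodule ℂ (Fin m → ℂ) → Prop := fun W =>
    ∃ hW : Inv W, ∃ P : MvPolynomial σ ℂ,
      (∀ a, MvPolynomial.eval a P = LinearMap.det ((T a).restrict (hW a))) ∧ B.det ∣ P
  -- every invariant `W` has a polynomial; uniqueness
  have hpoly : ∀ W (hW : Inv W), ∃ P : MvPolynomial σ ℂ,
      ∀ a, MvPolynomial.eval a P = LinearMap.det ((T a).restrict (hW a)) :=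
    fun W hW => exists_poly_det_restrict B hW
  -- (1) the top carries
  have htop : Carries ⊤ := by
    refine ⟨fun a => le_top.trans (le_of_eq (Submodule.comap_top _).symm), B.det, fun a => ?_, dvd_rfl⟩
    exact (det_restrict_top B a _).symm
  -- (2) carriers are closed under intersection
  have hinfC : ∀ W₁ W₂, Carries W₁ → Carries W₂ → Carries (W₁ ⊓ W₂) := by
    rintro W₁ W₂ ⟨h₁, P₁, hP₁, hd₁⟩ ⟨h₂, P₂, hP₂, hd₂⟩
    have hinf : Inv (W₁ ⊓ W₂) := fun a => inf_le_comap_of (T a) (h₁ a) (h₂ a)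
    have hsup : Inv (W₁ ⊔ W₂) := fun a => sup_le_comap_of (T a) (h₁ a) (h₂ a)
    obtain ⟨Pi, hPi⟩ := hpoly _ hinf
    obtain ⟨Ps, hPs⟩ := hpoly _ hsup
    refine ⟨hinf, Pi, hPi, ?_⟩
    rcases isUnit_or_det_dvd B hirr hinf hPi with hu | hdvd
    · exfalso
      have hid := poly_sup_mul_inf B h₁ h₂ hsup hinf hP₁ hP₂ hPs hPi
      -- `(det B)^2 ∣ Ps`, but `Ps ∣ det B`
      have h2 : B.det * B.det ∣ Ps := by
        have : B.det * B.det ∣ Ps * Pi := hid ▸ mul_dvd_mul hd₁ hd₂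
        exact hu.dvd_mul_right.mp this
      have h3 : Ps ∣ B.det := poly_restrict_dvd_det B hsup hPs
      obtain ⟨c, hc⟩ := h2.trans h3
      have hne : B.det ≠ 0 := hirr.ne_zero
      have : B.det * (B.det * c) = B.det * 1 := by rw [mul_one, ← mul_assoc]; exact hc.symm
      have hunit : IsUnit B.det := IsUnit.of_mul_eq_one _ (mul_left_cancel₀ hne this)
      exact hirr.not_isUnit hunit
    · exact hdvd
  -- (3) the least carrier, by dimension
  have hex : ∃ d, ∃ W, Carries W ∧ Module.finrank ℂ W = d := ⟨_, ⊤, htop, rfl⟩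
  obtain ⟨Wst, hWstC, hWstd⟩ := Nat.find_spec hex
  have hWstmin : ∀ W, Carries W → Wst ≤ W := by
    intro W hWC
    have hI := hinfC W Wst hWC hWstC
    have hle : Module.finrank ℂ Wst ≤ Module.finrank ℂ ↥(W ⊓ Wst) := by
      rw [hWstd]
      exact Nat.find_min' hex ⟨_, hI, rfl⟩
    have heq : W ⊓ Wst = Wst := Submodule.eq_of_le_of_finrank_le inf_le_right hle
    exact heq ▸ inf_le_left
  obtain ⟨hWst, Pst, hPst, hdst⟩ := hWstC
  -- (4) `W⋆ ≠ ⊥`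
  have hbot : (⊥ : Submodule ℂ (Fin m → ℂ)) < Wst := by
    rcases eq_or_lt_of_le (bot_le : (⊥ : Submodule ℂ (Fin m → ℂ)) ≤ Wst) with h | h
    · exfalso
      -- `P_⊥ = 1` would be a multiple of `det B`
      have hinv : Inv ⊥ := fun a => by simp
      have h1 : ∀ a, MvPolynomial.eval a (1 : MvPolynomial σ ℂ) =
          LinearMap.det ((T a).restrict (hinv a)) := fun a => by
        rw [map_one]; exact (det_restrict_bot B a _).symm
      have hPst1 : Pst = 1 :=
        MvPolynomial.funext fun a => by rw [hPst a, h1 a, det_restrict_congr (T a) h.symm]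
      exact not_isUnit_of_det_dvd B hirr hdst (hPst1 ▸ isUnit_one)
    · exact h
  -- (5) proper invariant subspaces of `W⋆` have unit polynomials
  have hproper : ∀ W (hW : Inv W), W < Wst → ∀ P, (∀ a, MvPolynomial.eval a P =
      LinearMap.det ((T a).restrict (hW a))) → IsUnit P := by
    intro W hW hlt P hP
    rcases isUnit_or_det_dvd B hirr hW hP with hu | hd
    · exact hu
    · exact absurd (hWstmin W ⟨hW, P, hP, hd⟩) (not_le_of_gt hlt)
  -- (6) the largest proper invariant subspace of `W⋆`, by dimension
  have hexU : ∃ d, ∃ W, ∃ _ : Inv W, W < Wst ∧ Module.finrank ℂ Wst - Module.finrank ℂ W = d :=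
    ⟨_, ⊥, fun a => by simp, hbot, rfl⟩
  obtain ⟨U, hU, hUlt, hUd⟩ := Nat.find_spec hexU
  have hUmax : ∀ W (hW : Inv W), W < Wst → W ≤ U := by
    intro W hW hlt
    have hsup : Inv (W ⊔ U) := fun a => sup_le_comap_of (T a) (hW a) (hU a)
    have hinf : Inv (W ⊓ U) := fun a => inf_le_comap_of (T a) (hW a) (hU a)
    obtain ⟨PW, hPW⟩ := hpoly W hW
    obtain ⟨PU, hPU⟩ := hpoly U hU
    obtain ⟨Ps, hPs⟩ := hpoly _ hsup
    obtain ⟨Pi, hPi⟩ := hpoly _ hinf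
    have huW := hproper W hW hlt PW hPW
    have huU := hproper U hU hUlt PU hPU
    have hid := poly_sup_mul_inf B hW hU hsup hinf hPW hPU hPs hPi
    have hus : IsUnit Ps := isUnit_of_mul_isUnit_left (hid ▸ huW.mul huU)
    -- so `W ⊔ U` is a proper invariant subspace of `W⋆`
    have hle : W ⊔ U ≤ Wst := sup_le hlt.le hUlt.le
    have hne : W ⊔ U ≠ Wst := by
      rintro heq
      have : IsUnit Pst := by
        have hPs' : ∀ a, MvPolynomial.eval a Ps = LinearMap.det ((T a).restrict (hWst a)) := by
          intro a; rw [hPs a, det_restrict_congr (T a) heq]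
        rw [MvPolynomial.funext fun a => (hPst a).trans (hPs' a).symm]
        exact hus
      exact not_isUnit_of_det_dvd B hirr hdst this
    have hlt' : W ⊔ U < Wst := lt_of_le_of_ne hle hne
    -- maximality of `U`
    have hdim : Module.finrank ℂ Wst - Module.finrank ℂ U ≤
        Module.finrank ℂ Wst - Module.finrank ℂ ↥(W ⊔ U) := by
      rw [hUd]
      exact Nat.find_min' hexU ⟨_, hsup, hlt', rfl⟩
    have hfin : Module.finrank ℂ ↥(W ⊔ U) ≤ Module.finrank ℂ U := by
      have h1 := Submodule.finrank_lt_finrank_of_lt hlt'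
      have h2 := Submodule.finrank_lt_finrank_of_lt hUlt
      omega
    have heq : U = W ⊔ U := Submodule.eq_of_le_of_finrank_le le_sup_right hfin
    exact le_sup_left.trans heq.symm.le
  obtain ⟨PU, hPU⟩ := hpoly U hU
  have huU : IsUnit PU := hproper U hU hUlt PU hPU
  refine ⟨Wst, U, hWst, hU, hUlt, ⟨Pst, hPst, hdst⟩, ⟨PU, hPU, huU⟩, hUmax, ?_⟩
  -- (7) transport under conjugating automorphisms
  intro G f hconj hdetf
  have hmapInv : ∀ W, Inv W → Inv (W.map (G : (Fin m → ℂ) →ₗ[ℂ] (Fin m → ℂ))) := fun W hW a =>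
    map_le_comap_of_conj (T a) (T (a ∘ f)) G (hconj a) (hW (a ∘ f))
  have hmapC : ∀ W, Carries W → Carries (W.map (G : (Fin m → ℂ) →ₗ[ℂ] (Fin m → ℂ))) := by
    rintro W ⟨hW, P, hP, hd⟩
    refine ⟨hmapInv W hW, MvPolynomial.rename f P, fun a => ?_, ?_⟩
    · rw [MvPolynomial.eval_rename, det_restrict_map_of_conj (T a) (T (a ∘ f)) G (hconj a) (hW (a ∘ f)),
        hP (a ∘ f)]
    · rw [← hdetf]; exact map_dvd (MvPolynomial.rename f) hd
  have hfr : ∀ W : Submodule ℂ (Fin m → ℂ),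
      Module.finrank ℂ ↥(W.map (G : (Fin m → ℂ) →ₗ[ℂ] (Fin m → ℂ))) = Module.finrank ℂ W :=
    fun W => (Submodule.equivMapOfInjective (G : (Fin m → ℂ) →ₗ[ℂ] (Fin m → ℂ))
      G.injective W).finrank_eq.symm
  have hWmap : Wst.map (G : (Fin m → ℂ) →ₗ[ℂ] (Fin m → ℂ)) = Wst := by
    have hle := hWstmin _ (hmapC Wst ⟨hWst, Pst, hPst, hdst⟩)
    exact (Submodule.eq_of_le_of_finrank_le hle (hfr Wst).le).symm
  refine ⟨hWmap, ?_⟩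
  have hlt : U.map (G : (Fin m → ℂ) →ₗ[ℂ] (Fin m → ℂ)) < Wst := by
    refine lt_of_le_of_ne ((Submodule.map_mono hUlt.le).trans hWmap.le) fun heq => ?_
    have h1 := Submodule.finrank_lt_finrank_of_lt hUlt
    rw [← heq, hfr] at h1
    exact lt_irrefl _ h1
  have hle := hUmax _ (hmapInv U hU) hlt
  exact Submodule.eq_of_le_of_finrank_le hle (hfr U).ge

end Lattice

end Summit.ValiantsHypothesis.ValiantsHypothesis.Theorems.SymPencilEquivariantSdcNotQP

end
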